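import Literature.MathematicalPhysics.QuantumFieldTheory.Balaban1983to89.B1Eq324BenfattoKernelSect5Ineq47Class
import Literature.MathematicalPhysics.QuantumFieldTheory.Balaban1983to89.B1Eq324BenfattoKernelSect5Ineq46Class
import Literature.MathematicalPhysics.QuantumFieldTheory.Balaban1983to89.B1Eq324BenfattoKernelSect5LedgerDischargeUpper
import HarnessLib

/-!
# `Balaban1983to89.B1Eq324BenfattoKernelSect5ClassBasicLemma` — [BenfattoEtAl1978] Lemma p. 152 (4.5)–(4.7) «Given an integer t ≧ 0 and b > b*, … There
# exist constants S, ρ₁, ρ₂, ρ₃, ρ₄ depending only on t, D, d, ϰ such that (4.6), and if C = ∅ (4.7)», FOR THE CLASS of [Balaban1985BackgroundPropagators]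
# Sect. E: THE ∃-KNIT — the two per-member sandwich halves under ONE threshold `b*` chosen BEFORE `t, D, ϰ` and before the member, and ONE SIGNED constant
# package `(S ≥ 0, ρ₁, ρ₂, ρ₃ > 0, ρ₄)`, in the shape n08-d's measure-free adapter `…Eq324Signed.eq324_of_sandwich_consts` consumes per instance

statement-level skeleton of published theorems with citation tags; proofs where landed; nothing here is a claim about the
Yang–Mills mass gap

WHY THIS MODULE (cell `pub-ymgap`, seat `dag-n08-c` gen 32, CLAIM-20; node N08 [Balaban1985UV3]; the [BenfattoEtAl1978] source chain behind the (α)-row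
`h324`).  The class road ends in two PER-MEMBER theorems of seat n08-b: `…KernelSect5Ineq47Class.ineq47_class_of_pack` ((4.7) for the Gaussian field
`μ_K` of a class member, in print's `|I|·errTerm S ρ₁ ρ₂ ρ₃ ρ₄ (coefSup …) b t` currency, from the lower pack `lowerpack_class'` at a pavement `(L, w, v)`
and an `L`-padding of `J` inside the member's window `Λ`) and `…KernelSect5Ineq46Class.ineq46_class_of_pack` ((4.6) for the conditioned field `P̄^K_{C,z̄}`,
from the upper pack `upperpack_class`, the same padding, `C ⊆ Λ` Euclidean-far from `J`).  The Lemma p. 152 quantifies differently: ONE `b*` (p. 159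
«b* can be chosen = max{10⁴, γ⁻³b̄}», free of `t, D, ϰ`), then for each `(t, D, ϰ)` ONE package `(S, ρ₁, …, ρ₄)` serving BOTH inequalities, every `b > b*`
and every datum; and its consumer toward row `h324c` (B1 (3.24), n08-d's `eq324_of_sandwich_consts`) needs the SIGNS `0 ≤ S`, `0 < ρ₃` recorded.  This file
does that bookkeeping and nothing else: the contraction `γ` is FIXED from the class constants (`γ := min 1 ((γ_A − J_c)/(4(VM + M₂V₄) + 1))`, so that both
centre-smallness rows of the knits hold), the threshold is `b* := max(b*_pack(γ), 16·M₂V₄/(θ(γ_A−J_c)) + 1)` (the second member kills the far term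
`e^{−θb³/4}` of the upper centre row), the exponents are the packs' floors (`ρ₁ = ρ₃ = D + 2d`, `ρ₂ = 0`, `ρ₄ = 8·s₁(D,D,d,ϰ)·γ^{−(d+1)D}·2^d + 1`),
`S := max S₄₇ S₄₆` (`…ErrTermLedger.errTerm_mono`), and the admissibility of a datum is stated at `b` alone: the sup-`b²`-thickening of `J` lies in `Λ`
(serves the packs' `L = ⌈b²⌉` padding) and `C` is `b³ + √d(b²+1)` Euclidean-far from `J` (serves the far radius `R = b³` at `L = ⌈b²⌉`).

WHAT IS PROVED (theorems only; no definition, no named fact, no `sorry`; axioms standard).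
* §1 bookkeeping rows: `pad_of_sq_pad`, `far_of_far`, `gamma_rows`, `far_term_le_quarter`.
* §2 ★★★ `classBasicLemma_signed` — for `d ≥ 1` and class constants `γ_A ≥ 2` (the variance normalisation `K(x,x) ≤ 1/γ_A ≤ ½`, print's «E z_Δ² = ½»),
  `0 ≤ J_c < γ_A`, `θ > 0`, `V, M, V₂, M₂, V₄ ≥ 0`:  `∃ b*, ∀ t D ϰ > 0, ∃ S ρ₁ ρ₂ ρ₃ ρ₄, 0 ≤ S ∧ 0 < ρ₃ ∧ ∀` member `(Λ, A, K)` with those rows,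
  `∀ s, ∀ b > b*, ∀ I ⊇ J` (`I ≠ ∅`, `J` padded in `Λ` at `b²`), `∀ 𝔄`: [(4.6) for every `C ⊆ Λ` far from `J` and every `z̄`] ∧ [(4.7)] — binder order of
  `B1Eq324BenfattoLemma.BasicLemma`, currencies literally those of `eq324_of_sandwich_consts` (at `C = ∅`, `…KernelCondField.condFieldK_empty` turns the
  (4.6) clause into the upper half for `μ_K`).
* §3 (v1.1) ★★★ `classBasicLemma_signed'` — the same with `0 ≤ S ∧ 0 ≤ ρ₁ ∧ 0 ≤ ρ₂ ∧ 0 < ρ₃ ∧ 0 ≤ ρ₄` exported (n08-d's collar absorption needs `0 ≤ ρ₄`).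

HONEST SCOPE / NOT HERE.  Quantifier bookkeeping over seat n08-b's two per-member theorems and packs (applied BY NAME; no estimate is re-proved); the class,
its constants and the two normalisations (`γ_A ≥ 2`, the window padding) are OURS, not print's `P̂₀` on `ℤ^d`; B1 (3.24) for `μ_K` is the next, measure-free
step (n08-d `…KernelEq324`); the instantiation at [Balaban1985UV3]'s objects (the member, its rows from N06's bounds, the measure bridge, the (α)-letters) is
the UNCOMMISSIONED class-II IDENT — nothing of it is here; nothing of [Balaban1985UV3] / [Balaban1985UV2] is asserted; count-neutral for N08; nothing about
d = 4, the continuum, OS axioms, a mass gap or the Clay problem.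
-/

open MeasureTheory Finset
open scoped BigOperators

namespace Literature.MathematicalPhysics.QuantumFieldTheory.Balaban1983to89.B1Eq324BenfattoKernelSect5ClassBasicLemma

open _root_.MeasureTheory
open Literature.MathematicalPhysics.QuantumFieldTheory
open Literature.MathematicalPhysics.QuantumFieldTheory.Balaban1983to89.B1Eq324BenfattoLemma
open Literature.MathematicalPhysics.QuantumFieldTheory.Balaban1983to89.B1Eq324BenfattoSect5Eq511 (s1Const)
open Literature.MathematicalPhysics.QuantumFieldTheory.Balaban1983to89.B1Eq324BenfattoSpecialisation (coefSup_nonneg)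
open Literature.MathematicalPhysics.QuantumFieldTheory.Balaban1983to89.B1Eq324BenfattoSect5ErrTermLedger (errTerm_mono)
open Literature.MathematicalPhysics.QuantumFieldTheory.Balaban1983to89.B1Eq324BenfattoKernelSect5LedgerDischargeLower (lowerpack_class')
open Literature.MathematicalPhysics.QuantumFieldTheory.Balaban1983to89.B1Eq324BenfattoKernelSect5LedgerDischargeUpper (upperpack_class)
open Literature.MathematicalPhysics.QuantumFieldTheory.Balaban1983to89.B1Eq324BenfattoKernelSect5Ineq47Class (ineq47_class_of_pack)
open Literature.MathematicalPhysics.QuantumFieldTheory.Balaban1983to89.B1Eq324BenfattoKernelSect5Ineq46Class (ineq46_class_of_pack)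

variable {d : ℕ}

/-! ## §1  Bookkeeping rows: admissibility at `b`, the contraction, the far threshold -/

section Rows

/-- **Padding at `b²` serves the chain's padding at `L = ⌈b²⌉`**: if every site within sup-distance `b²` of `J` lies in `Λ`, then every site within
sup-distance `< L` of `J` does (`⌈b²⌉ − 1 < b²`). [cite: BenfattoEtAl1978, §5 p.154 «L ≈ b²» (class form; ours)] -/
theorem pad_of_sq_pad {Λ J : Finset (B1Eq324BenfattoLemma.Site d)} {b : ℝ} {L : ℕ} (hLdef : L = ⌈b ^ 2⌉₊)
    (H : ∀ x ∈ J, ∀ z : B1Eq324BenfattoLemma.Site d, (∀ i, ((|z i - x i| : ℤ) : ℝ) ≤ b ^ 2) → z ∈ Λ) :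
    ∀ x ∈ J, ∀ z : B1Eq324BenfattoLemma.Site d, (∀ i, |z i - x i| < (L : ℤ)) → z ∈ Λ := by
  intro x hx z hz
  refine H x hx z fun i => ?_
  have h1 : |z i - x i| ≤ (L : ℤ) - 1 := Int.le_sub_one_of_lt (hz i)
  have h2 : ((|z i - x i| : ℤ) : ℝ) ≤ (L : ℝ) - 1 := by exact_mod_cast h1
  have h3 : (L : ℝ) < b ^ 2 + 1 := by
    rw [hLdef]
    exact Nat.ceil_lt_add_one (sq_nonneg b)
  linarith

/-- **Far at `b³ + √d(b²+1)` serves the chain's far radius `R = b³` at `L = ⌈b²⌉`** (`⌈b²⌉ ≤ b² + 1`).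
[cite: BenfattoEtAl1978, Lemma p.152 «C … at distance b³ from J» (class form; ours)] -/
theorem far_of_far {C J : Finset (B1Eq324BenfattoLemma.Site d)} {b : ℝ} {L : ℕ} (hLdef : L = ⌈b ^ 2⌉₊)
    (H : ∀ c ∈ C, ∀ x ∈ J, b ^ 3 + Real.sqrt d * (b ^ 2 + 1) ≤ Real.sqrt (∑ j, (((x j : ℝ) - (c j : ℝ))) ^ 2)) :
    ∀ c ∈ C, ∀ x ∈ J, b ^ 3 + Real.sqrt d * (L : ℝ) ≤ Real.sqrt (∑ j, (((x j : ℝ) - (c j : ℝ))) ^ 2) := by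
  intro c hc x hx
  refine le_trans ?_ (H c hc x hx)
  have h3 : (L : ℝ) ≤ b ^ 2 + 1 := by
    rw [hLdef]
    exact (Nat.ceil_lt_add_one (sq_nonneg b)).le
  have h4 : 0 ≤ Real.sqrt d := Real.sqrt_nonneg d
  nlinarith

/-- **The contraction fixed from the class constants**: `γ := min 1 ((γ_A − J_c)/(4(VM + M₂V₄) + 1))` is in `(0, 1]` and makes BOTH centre-smallness rows of
the knits hold: `VM/(γ_A−J_c)·γ ≤ ½` (lower, `…KernelSect5LowerAssembly`'s `hsmallγ`) and `M₂V₄/(γ_A−J_c)·γ ≤ ¼` (half of the upper row `hsmallU`).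
[cite: BenfattoEtAl1978, §5 p.159 «γ small enough», Appendix C Lemma 2 p.165 (class form; ours)] -/
theorem gamma_rows {γA Jc V M M₂ V₄ : ℝ} (hJcγ : Jc < γA) (hV : 0 ≤ V) (hM : 0 ≤ M) (hM₂ : 0 ≤ M₂) (hV₄ : 0 ≤ V₄) :
    0 < min 1 ((γA - Jc) / (4 * (V * M + M₂ * V₄) + 1)) ∧ min 1 ((γA - Jc) / (4 * (V * M + M₂ * V₄) + 1)) ≤ 1 ∧
      V * M / (γA - Jc) * min 1 ((γA - Jc) / (4 * (V * M + M₂ * V₄) + 1)) ≤ 1 / 2 ∧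
      M₂ * V₄ / (γA - Jc) * min 1 ((γA - Jc) / (4 * (V * M + M₂ * V₄) + 1)) ≤ 1 / 4 := by
  have hg : 0 < γA - Jc := by linarith
  have hden : 0 < 4 * (V * M + M₂ * V₄) + 1 := by positivity
  have hq : 0 < (γA - Jc) / (4 * (V * M + M₂ * V₄) + 1) := div_pos hg hden
  refine ⟨lt_min one_pos hq, min_le_left _ _, ?_, ?_⟩
  · calc V * M / (γA - Jc) * min 1 ((γA - Jc) / (4 * (V * M + M₂ * V₄) + 1))
        ≤ V * M / (γA - Jc) * ((γA - Jc) / (4 * (V * M + M₂ * V₄) + 1)) :=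
          mul_le_mul_of_nonneg_left (min_le_right _ _) (div_nonneg (mul_nonneg hV hM) hg.le)
      _ = V * M / (4 * (V * M + M₂ * V₄) + 1) := by field_simp
      _ ≤ 1 / 2 := by
          rw [div_le_iff₀ hden]
          nlinarith [mul_nonneg hV hM, mul_nonneg hM₂ hV₄]
  · calc M₂ * V₄ / (γA - Jc) * min 1 ((γA - Jc) / (4 * (V * M + M₂ * V₄) + 1))
        ≤ M₂ * V₄ / (γA - Jc) * ((γA - Jc) / (4 * (V * M + M₂ * V₄) + 1)) :=
          mul_le_mul_of_nonneg_left (min_le_right _ _) (div_nonneg (mul_nonneg hM₂ hV₄) hg.le)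
      _ = M₂ * V₄ / (4 * (V * M + M₂ * V₄) + 1) := by field_simp
      _ ≤ 1 / 4 := by
          rw [div_le_iff₀ hden]
          nlinarith [mul_nonneg hV hM, mul_nonneg hM₂ hV₄]

/-- **The far term of the upper centre row is `≤ ¼` beyond an explicit threshold**: `16·M₂V₄/(θ(γ_A−J_c)) + 1 ≤ b` gives
`M₂V₄/(γ_A−J_c)·e^{−θb³/4} ≤ ¼` (`e^{−x} ≤ 1/(1+x)`, `b³ ≥ b ≥ 1`). [cite: BenfattoEtAl1978, Lemma p.152 «at distance b³», §5 (5.30)–(5.31) p.158 (class form; ours)] -/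
theorem far_term_le_quarter {γA Jc θ M₂ V₄ b : ℝ} (hJcγ : Jc < γA) (hθ : 0 < θ) (hM₂ : 0 ≤ M₂) (hV₄ : 0 ≤ V₄)
    (hb : 16 * (M₂ * V₄) / (θ * (γA - Jc)) + 1 ≤ b) :
    M₂ * V₄ / (γA - Jc) * Real.exp (-(θ / 4 * b ^ 3)) ≤ 1 / 4 := by
  have hg : 0 < γA - Jc := by linarith
  have hP : 0 ≤ M₂ * V₄ := mul_nonneg hM₂ hV₄
  have hb1 : 1 ≤ b := by
    have : 0 ≤ 16 * (M₂ * V₄) / (θ * (γA - Jc)) := by positivity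
    linarith
  have hb0 : 0 < b := by linarith
  have hx : 0 < θ / 4 * b ^ 3 := by positivity
  have h1 : Real.exp (-(θ / 4 * b ^ 3)) ≤ 1 / (θ / 4 * b ^ 3) := by
    rw [Real.exp_neg, one_div]
    exact inv_anti₀ hx ((le_add_of_nonneg_left zero_le_one).trans (by simpa [add_comm] using Real.add_one_le_exp (θ / 4 * b ^ 3)))
  have hb3 : b ≤ b ^ 3 := by
    calc b = b * 1 * 1 := by ring
      _ ≤ b * b * b := by gcongr
      _ = b ^ 3 := by ring
  have h2 : 1 / (θ / 4 * b ^ 3) ≤ 4 / (θ * b) := by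
    rw [div_le_div_iff₀ hx (by positivity)]
    nlinarith [mul_pos hθ hb0]
  have h3 : M₂ * V₄ / (γA - Jc) * (4 / (θ * b)) ≤ 1 / 4 := by
    rw [div_mul_div_comm, div_le_iff₀ (by positivity)]
    have h4 : 16 * (M₂ * V₄) / (θ * (γA - Jc)) ≤ b - 1 := by linarith
    have h5 : 16 * (M₂ * V₄) ≤ (b - 1) * (θ * (γA - Jc)) := by
      rwa [div_le_iff₀ (by positivity)] at h4
    nlinarith [mul_pos hθ hg]
  calc M₂ * V₄ / (γA - Jc) * Real.exp (-(θ / 4 * b ^ 3))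
      ≤ M₂ * V₄ / (γA - Jc) * (4 / (θ * b)) :=
        mul_le_mul_of_nonneg_left (h1.trans h2) (div_nonneg hP hg.le)
    _ ≤ 1 / 4 := h3

end Rows

/-! ## §2  The Lemma of p. 152 for the class, signed shape -/

section Knit

/-- ★★★ **THE LEMMA OF p. 152 FOR THE CLASS, SIGNED SHAPE** — «Given an integer `t ≥ 0` and `b > b*`, let `J ⊆ I` and `C` be regions …; there exist constants
`S, ρ₁, ρ₂, ρ₃, ρ₄` depending only on `t, D, d, ϰ` [and the class constants] such that (4.6), and if `C = ∅` (4.7)».  For `d ≥ 1` and class constants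
`γ_A ≥ 2`, `0 ≤ J_c < γ_A`, `θ > 0`, `V, M, V₂, M₂, V₄ ≥ 0` there is ONE threshold `b*` such that for all `t, D` and `ϰ > 0` there is ONE package
`(S ≥ 0, ρ₁, ρ₂, ρ₃ > 0, ρ₄)` with: for every class member `(Λ, A, K)` (`K = A⁻¹` zero-extended off the window `Λ ≠ ∅`; `A` symmetric, `γ_A`-coercive, with
the Euclidean Combes–Thomas row `J_c`, growth rows `V, M`, half-rate rows `V₂, M₂`, quarter-rate growth row `V₄` at rate `θ`), every `s`, every `b > b*`, every
`J ⊆ I` with `I ≠ ∅` and the sup-`b²`-thickening of `J` inside `Λ`, and every coefficient family `𝔄`: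
(4.6) `∫Π_{Δ⊂I}χ̂_b e^{H^𝔄_J} dP̄^K_{C,z̄} ≤ exp(Σ_{k≤t}𝓔^T_{μ_K}(H^𝔄_J;k)/k! + |I|·errTerm S ρ 𝔄 b t)` for every `C ⊆ Λ` with `|x − c|₂ ≥ b³ + √d(b²+1)`
(`x ∈ J`, `c ∈ C`) and every `z̄`, AND (4.7) `exp(Σ_{k≤t}𝓔^T_{μ_K}(H^𝔄_J;k)/k! − |I|·errTerm S ρ 𝔄 b t) ≤ ∫Π_{Δ⊂I}χ̂_b e^{H^𝔄_J} dμ_K`.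
Proof: seat n08-b's `ineq47_class_of_pack` / `ineq46_class_of_pack` with their packs `lowerpack_class'` / `upperpack_class` BY NAME at the contraction of
`gamma_rows`, the threshold `max(b*_pack, far threshold)`, the exponents at the packs' floors and `S := max S₄₇ S₄₆` (`errTerm_mono`).
[cite: BenfattoEtAl1978, Lemma p.152 (4.5)–(4.7), Remark 1; §5 pp.153–159, «b*» p.159; Balaban1985BackgroundPropagators, (1.16)–(1.18) p.180, Sect. E p.428 (class form; ours)] -/
theorem classBasicLemma_signed (hd : 0 < d) {γA Jc θ V M V₂ M₂ V₄ : ℝ} (hγA2 : 2 ≤ γA) (hJc0 : 0 ≤ Jc) (hJcγ : Jc < γA) (hθ : 0 < θ)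
    (hV0 : 0 ≤ V) (hM0 : 0 ≤ M) (hV₂0 : 0 ≤ V₂) (hM₂0 : 0 ≤ M₂) (hV₄0 : 0 ≤ V₄) :
    ∃ bstar : ℝ, ∀ (t D : ℕ) (κ : ℝ), 0 < κ →
      ∃ S ρ₁ ρ₂ ρ₃ ρ₄ : ℝ, 0 ≤ S ∧ 0 < ρ₃ ∧
        ∀ {Λ : Finset (B1Eq324BenfattoLemma.Site d)} {A : Matrix Λ Λ ℝ} {K : B1Eq324BenfattoLemma.Site d → B1Eq324BenfattoLemma.Site d → ℝ},
          (∀ x y, K x y = if h : x ∈ Λ ∧ y ∈ Λ then (A⁻¹ : Matrix Λ Λ ℝ) ⟨x, h.1⟩ ⟨y, h.2⟩ else 0) → Λ.Nonempty →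
          (∀ e e', A e e' = A e' e) → (∀ x : Λ → ℝ, γA * ∑ e, x e ^ 2 ≤ ∑ e, ∑ e', A e e' * x e * x e') →
          (∀ e : Λ, ∑ e' : Λ, |A e e'| * (Real.cosh (θ * Real.sqrt (∑ j, ((((e : B1Eq324BenfattoLemma.Site d) j : ℝ) - ((e' : B1Eq324BenfattoLemma.Site d) j : ℝ))) ^ 2)) - 1) ≤ Jc) →
          (∀ e : Λ, ∑ e' : Λ, Real.exp (-(θ * Real.sqrt (∑ j, ((((e : B1Eq324BenfattoLemma.Site d) j : ℝ) - ((e' : B1Eq324BenfattoLemma.Site d) j : ℝ))) ^ 2))) *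
            (1 + Real.sqrt (∑ j, ((((e : B1Eq324BenfattoLemma.Site d) j : ℝ) - ((e' : B1Eq324BenfattoLemma.Site d) j : ℝ))) ^ 2)) ≤ V) →
          (∀ e : Λ, ∑ e' : Λ, |A e e'| * (1 + Real.sqrt (∑ j, ((((e : B1Eq324BenfattoLemma.Site d) j : ℝ) - ((e' : B1Eq324BenfattoLemma.Site d) j : ℝ))) ^ 2)) ≤ M) →
          (∀ e : Λ, ∑ e' : Λ, Real.exp (-(θ / 2 * Real.sqrt (∑ j, ((((e : B1Eq324BenfattoLemma.Site d) j : ℝ) - ((e' : B1Eq324BenfattoLemma.Site d) j : ℝ))) ^ 2))) ≤ V₂) →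
          (∀ e : Λ, ∑ e' : Λ, |A e e'| * Real.exp (θ / 2 * Real.sqrt (∑ j, ((((e : B1Eq324BenfattoLemma.Site d) j : ℝ) - ((e' : B1Eq324BenfattoLemma.Site d) j : ℝ))) ^ 2)) ≤ M₂) →
          (∀ e : Λ, ∑ e' : Λ, Real.exp (-(θ / 4 * Real.sqrt (∑ j, ((((e : B1Eq324BenfattoLemma.Site d) j : ℝ) - ((e' : B1Eq324BenfattoLemma.Site d) j : ℝ))) ^ 2))) *
            (1 + Real.sqrt (∑ j, ((((e : B1Eq324BenfattoLemma.Site d) j : ℝ) - ((e' : B1Eq324BenfattoLemma.Site d) j : ℝ))) ^ 2)) ≤ V₄) →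
          ∀ (s : ℕ) (b : ℝ), bstar < b → ∀ (I J : Finset (B1Eq324BenfattoLemma.Site d)), I.Nonempty → J ⊆ I →
            (∀ x ∈ J, ∀ z : B1Eq324BenfattoLemma.Site d, (∀ i, ((|z i - x i| : ℤ) : ℝ) ≤ b ^ 2) → z ∈ Λ) → ∀ a : Coef d,
            (∀ (C : Finset (B1Eq324BenfattoLemma.Site d)) (zbar : B1Eq324BenfattoLemma.Site d → ℝ), C ⊆ Λ →
                (∀ c ∈ C, ∀ x ∈ J, b ^ 3 + Real.sqrt d * (b ^ 2 + 1) ≤ Real.sqrt (∑ j, (((x j : ℝ) - (c j : ℝ))) ^ 2)) →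
                ∫ z, cutoffBoltzmann (hamiltonian s D κ a J) I b z ∂((gaussianFieldOfKernel (condCov K C)).map
                    fun (ζ' : B1Eq324BenfattoLemma.Site d → ℝ) (x : B1Eq324BenfattoLemma.Site d) => condMean K C zbar x + ζ' x) ≤
                  Real.exp (cumulantSum (gaussianFieldOfKernel K) (hamiltonian s D κ a J) t +
                    (I.card : ℝ) * errTerm S ρ₁ ρ₂ ρ₃ ρ₄ (coefSup s D a J) b t)) ∧
            Real.exp (cumulantSum (gaussianFieldOfKernel K) (hamiltonian s D κ a J) t -
                  (I.card : ℝ) * errTerm S ρ₁ ρ₂ ρ₃ ρ₄ (coefSup s D a J) b t) ≤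
                ∫ z, cutoffBoltzmann (hamiltonian s D κ a J) I b z ∂gaussianFieldOfKernel K := by
  classical
  -- the contraction, fixed from the class constants
  obtain ⟨hγ0, hγ1, hsmallγ, hquarter⟩ := gamma_rows hJcγ hV0 hM0 hM₂0 hV₄0
  set γ : ℝ := min 1 ((γA - Jc) / (4 * (V * M + M₂ * V₄) + 1)) with hγdef
  have hγA0 : 0 < γA := by linarith
  have hhalf : 1 / γA ≤ 1 / 2 := one_div_le_one_div_of_le two_pos hγA2
  -- the threshold: the packs' `b*` at this `γ`, and the far threshold of the upper centre row
  refine ⟨max (6 * 2 ^ d * ((d + 1).factorial : ℝ) * (4 / (γ ^ d) ^ 2) ^ (d + 1)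
      + 10 * (d + 1) * ((⌈1 / (2 * θ) + Real.sqrt (Jc / γA) / θ⌉₊ + 1 : ℕ) : ℝ) + 2 / (γ ^ (d + 1) * Real.sqrt γA) + (γ ^ (d + 1))⁻¹ + 1)
      (16 * (M₂ * V₄) / (θ * (γA - Jc)) + 1), fun t D κ hκ => ?_⟩
  -- the exponents at the packs' floors (the upper `ρ₄`-floor dominates the lower one)
  have hρ₄' : 8 * s1Const D D d κ * 1 ^ D * 2 ^ d + 1 ≤ 8 * s1Const D D d κ * (γ ^ (d + 1))⁻¹ ^ D * 2 ^ d + 1 := by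
    have hS : 0 ≤ s1Const D D d κ := B1Eq324BenfattoSect5ErrTermLedger.s1Const_nonneg D D d hκ.le
    have h1 : (1 : ℝ) ^ D ≤ (γ ^ (d + 1))⁻¹ ^ D := by
      rw [one_pow]
      exact one_le_pow₀ (one_le_inv_iff₀.mpr ⟨pow_pos hγ0 _, pow_le_one₀ hγ0.le hγ1⟩)
    have h2 : 0 ≤ 8 * s1Const D D d κ := by positivity
    nlinarith [mul_le_mul_of_nonneg_left h1 h2, pow_nonneg (zero_le_two (α := ℝ)) d]
  obtain ⟨S₇, δ₇, hS₇, hδ₇, hδle₇, hres₇, hall₇⟩ := lowerpack_class' hd hγA0 hJc0 hJcγ hθ hV0 hM0 hV₂0 hM₂0 hV₄0 hγ0 hγ1 t D hκ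
    (ρ₁ := (D : ℝ) + 2 * d) (ρ₂ := 0) (ρ₃ := (D : ℝ) + 2 * d) le_rfl le_rfl le_rfl hρ₄' (le_max_left _ (16 * (M₂ * V₄) / (θ * (γA - Jc)) + 1))
  obtain ⟨S₆, δ₆, hS₆, hδ₆, hδle₆, hres₆, hall₆⟩ := upperpack_class hd hγA0 hJc0 hJcγ hθ hV0 hM0 hV₂0 hM₂0 hV₄0 hγ0 hγ1 t D hκ
    (ρ₁ := (D : ℝ) + 2 * d) (ρ₂ := 0) (ρ₃ := (D : ℝ) + 2 * d) le_rfl le_rfl le_rfl le_rfl (le_max_left _ (16 * (M₂ * V₄) / (θ * (γA - Jc)) + 1))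
  refine ⟨max S₇ S₆, (D : ℝ) + 2 * d, 0, (D : ℝ) + 2 * d, 8 * s1Const D D d κ * (γ ^ (d + 1))⁻¹ ^ D * 2 ^ d + 1,
    le_max_of_le_left hS₇, by positivity, ?_⟩
  intro Λ A K hK hΛ hAs hγA hJc hV hM hV₂ hM₂ hV₄ s b hb I J hI hJI hpad a
  have hbU : 16 * (M₂ * V₄) / (θ * (γA - Jc)) + 1 ≤ b := (le_max_right _ _).trans hb.le
  have hb0 : 0 ≤ b := by
    have : 0 ≤ 16 * (M₂ * V₄) / (θ * (γA - Jc)) := by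
      have hg : 0 < γA - Jc := by linarith
      positivity
    linarith
  have hA0 : 0 ≤ coefSup s D a J := coefSup_nonneg s D a J
  have hI1 : (1 : ℝ) ≤ (I.card : ℝ) := by exact_mod_cast Finset.card_pos.mpr hI
  have hI0 : (0 : ℝ) ≤ (I.card : ℝ) := Nat.cast_nonneg _
  have hmono₇ := mul_le_mul_of_nonneg_left
    (errTerm_mono (ρ₁ := (D : ℝ) + 2 * d) (ρ₂ := 0) (ρ₃ := (D : ℝ) + 2 * d)
      (ρ₄ := 8 * s1Const D D d κ * (γ ^ (d + 1))⁻¹ ^ D * 2 ^ d + 1) (t := t) (le_max_left S₇ S₆) hA0 hb0) hI0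
  have hmono₆ := mul_le_mul_of_nonneg_left
    (errTerm_mono (ρ₁ := (D : ℝ) + 2 * d) (ρ₂ := 0) (ρ₃ := (D : ℝ) + 2 * d)
      (ρ₄ := 8 * s1Const D D d κ * (γ ^ (d + 1))⁻¹ ^ D * 2 ^ d + 1) (t := t) (le_max_right S₇ S₆) hA0 hb0) hI0
  constructor
  · -- (4.6): the upper pack at `b`, its pavement, the per-member upper theorem, then `S₄₆ ≤ S`
    intro C zbar hC0 hCfar
    obtain ⟨L, w, v, hLdef, hwv, hL2, hfit, hv, hw, hb1, hsmall, hguard, hW1, hW2, hwv3, hclause⟩ := hall₆ b hb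
    have hsmallU : M₂ * V₄ / (γA - Jc) * (γ + Real.exp (-(θ / 4 * b ^ 3))) ≤ 1 / 2 := by
      rw [mul_add]
      linarith [far_term_le_quarter hJcγ hθ hM₂0 hV₄0 hbU]
    have h46 := ineq46_class_of_pack hK hΛ hAs hγA0 hγA hθ hJc hJcγ hV hM hV₂ hM₂ hV₄ hJc0 hV0 hM0 hV₂0 hM₂0 hV₄0 hhalf hκ hγ0 hγ1
      hsmallU hδ₆ hδle₆ hres₆ t hL2 hfit hv hw hb1 hsmall hguard hW1 hW2 hJI a rfl (pad_of_sq_pad hLdef hpad) hC0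
      (far_of_far hLdef hCfar) zbar (fun n hn => hclause s n (I.card : ℝ) (coefSup s D a J) hn hI1 hA0)
    exact h46.trans (Real.exp_le_exp.mpr (by linarith))
  · -- (4.7): the lower pack at `b`, its pavement, the per-member lower theorem, then `S₄₇ ≤ S`
    obtain ⟨L, w, v, hLdef, hwv, hL2, hfit, hv, hw, hgb1, hsmall, hguard, hW1, hW2, hterm, hclause⟩ := hall₇ b hb
    have h47 := ineq47_class_of_pack hK hΛ hAs hγA0 hγA hθ hJc hJcγ hV hM hV₂ hM₂ hV₄ hJc0 hV0 hM0 hV₂0 hM₂0 hV₄0 hhalf hκ hγ0 hγ1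
      hsmallγ hδ₇ hδle₇ hres₇ t hL2 hfit hv hw hgb1 hsmall hguard hW1 hW2 hterm hJI hI a rfl (pad_of_sq_pad hLdef hpad)
      (fun n hn => hclause s n (I.card : ℝ) (coefSup s D a J) hn hI1 hA0)
    exact le_trans (Real.exp_le_exp.mpr (by linarith)) h47


/-! ## §3 (v1.1, APPEND-ONLY)  The same knit with all exponent signs recorded -/

/-- ★★★ **THE LEMMA OF p. 152 FOR THE CLASS, SIGNED SHAPE, ALL EXPONENT SIGNS RECORDED** (v1.1, APPEND-ONLY) — the same statement as
`classBasicLemma_signed` with the signs of ALL constants exported: `0 ≤ S ∧ 0 ≤ ρ₁ ∧ 0 ≤ ρ₂ ∧ 0 < ρ₃ ∧ 0 ≤ ρ₄` (the knit's package is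
`(max S₄₇ S₄₆, D + 2d, 0, D + 2d, 8·s₁(D,D,d,ϰ)·γ^{−(d+1)D}·2^d + 1)`).  Seat n08-d's no-padding (3.24) for `μ_K` (`…KernelEq324` §3, the collar member of
`…` p633772) absorbs the collar defect into `|I|·errTerm (S + 4·8^d) …` through the second summand `S·e^{−ρ₃b^{3/2}}·e^{ρ₄·A·b^{ρ₃}}`, which needs `0 ≤ ρ₄`
(asked I.≈37700, after v1.0 was filed; an `∃` hides its witnesses, so the conjuncts cannot be derived from v1.0 — the proof is v1.0's, re-run).
[cite: BenfattoEtAl1978, Lemma p.152 (4.5)–(4.7), Remark 1; §5 pp.153–159, «b*» p.159; Balaban1985BackgroundPropagators, (1.16)–(1.18) p.180, Sect. E p.428 (class form; ours)] -/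
theorem classBasicLemma_signed' (hd : 0 < d) {γA Jc θ V M V₂ M₂ V₄ : ℝ} (hγA2 : 2 ≤ γA) (hJc0 : 0 ≤ Jc) (hJcγ : Jc < γA) (hθ : 0 < θ)
    (hV0 : 0 ≤ V) (hM0 : 0 ≤ M) (hV₂0 : 0 ≤ V₂) (hM₂0 : 0 ≤ M₂) (hV₄0 : 0 ≤ V₄) :
    ∃ bstar : ℝ, ∀ (t D : ℕ) (κ : ℝ), 0 < κ →
      ∃ S ρ₁ ρ₂ ρ₃ ρ₄ : ℝ, 0 ≤ S ∧ 0 ≤ ρ₁ ∧ 0 ≤ ρ₂ ∧ 0 < ρ₃ ∧ 0 ≤ ρ₄ ∧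
        ∀ {Λ : Finset (B1Eq324BenfattoLemma.Site d)} {A : Matrix Λ Λ ℝ} {K : B1Eq324BenfattoLemma.Site d → B1Eq324BenfattoLemma.Site d → ℝ},
          (∀ x y, K x y = if h : x ∈ Λ ∧ y ∈ Λ then (A⁻¹ : Matrix Λ Λ ℝ) ⟨x, h.1⟩ ⟨y, h.2⟩ else 0) → Λ.Nonempty →
          (∀ e e', A e e' = A e' e) → (∀ x : Λ → ℝ, γA * ∑ e, x e ^ 2 ≤ ∑ e, ∑ e', A e e' * x e * x e') →
          (∀ e : Λ, ∑ e' : Λ, |A e e'| * (Real.cosh (θ * Real.sqrt (∑ j, ((((e : B1Eq324BenfattoLemma.Site d) j : ℝ) - ((e' : B1Eq324BenfattoLemma.Site d) j : ℝ))) ^ 2)) - 1) ≤ Jc) →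
          (∀ e : Λ, ∑ e' : Λ, Real.exp (-(θ * Real.sqrt (∑ j, ((((e : B1Eq324BenfattoLemma.Site d) j : ℝ) - ((e' : B1Eq324BenfattoLemma.Site d) j : ℝ))) ^ 2))) *
            (1 + Real.sqrt (∑ j, ((((e : B1Eq324BenfattoLemma.Site d) j : ℝ) - ((e' : B1Eq324BenfattoLemma.Site d) j : ℝ))) ^ 2)) ≤ V) →
          (∀ e : Λ, ∑ e' : Λ, |A e e'| * (1 + Real.sqrt (∑ j, ((((e : B1Eq324BenfattoLemma.Site d) j : ℝ) - ((e' : B1Eq324BenfattoLemma.Site d) j : ℝ))) ^ 2)) ≤ M) →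
          (∀ e : Λ, ∑ e' : Λ, Real.exp (-(θ / 2 * Real.sqrt (∑ j, ((((e : B1Eq324BenfattoLemma.Site d) j : ℝ) - ((e' : B1Eq324BenfattoLemma.Site d) j : ℝ))) ^ 2))) ≤ V₂) →
          (∀ e : Λ, ∑ e' : Λ, |A e e'| * Real.exp (θ / 2 * Real.sqrt (∑ j, ((((e : B1Eq324BenfattoLemma.Site d) j : ℝ) - ((e' : B1Eq324BenfattoLemma.Site d) j : ℝ))) ^ 2)) ≤ M₂) →
          (∀ e : Λ, ∑ e' : Λ, Real.exp (-(θ / 4 * Real.sqrt (∑ j, ((((e : B1Eq324BenfattoLemma.Site d) j : ℝ) - ((e' : B1Eq324BenfattoLemma.Site d) j : ℝ))) ^ 2))) *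
            (1 + Real.sqrt (∑ j, ((((e : B1Eq324BenfattoLemma.Site d) j : ℝ) - ((e' : B1Eq324BenfattoLemma.Site d) j : ℝ))) ^ 2)) ≤ V₄) →
          ∀ (s : ℕ) (b : ℝ), bstar < b → ∀ (I J : Finset (B1Eq324BenfattoLemma.Site d)), I.Nonempty → J ⊆ I →
            (∀ x ∈ J, ∀ z : B1Eq324BenfattoLemma.Site d, (∀ i, ((|z i - x i| : ℤ) : ℝ) ≤ b ^ 2) → z ∈ Λ) → ∀ a : Coef d,
            (∀ (C : Finset (B1Eq324BenfattoLemma.Site d)) (zbar : B1Eq324BenfattoLemma.Site d → ℝ), C ⊆ Λ →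
                (∀ c ∈ C, ∀ x ∈ J, b ^ 3 + Real.sqrt d * (b ^ 2 + 1) ≤ Real.sqrt (∑ j, (((x j : ℝ) - (c j : ℝ))) ^ 2)) →
                ∫ z, cutoffBoltzmann (hamiltonian s D κ a J) I b z ∂((gaussianFieldOfKernel (condCov K C)).map
                    fun (ζ' : B1Eq324BenfattoLemma.Site d → ℝ) (x : B1Eq324BenfattoLemma.Site d) => condMean K C zbar x + ζ' x) ≤
                  Real.exp (cumulantSum (gaussianFieldOfKernel K) (hamiltonian s D κ a J) t +
                    (I.card : ℝ) * errTerm S ρ₁ ρ₂ ρ₃ ρ₄ (coefSup s D a J) b t)) ∧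
            Real.exp (cumulantSum (gaussianFieldOfKernel K) (hamiltonian s D κ a J) t -
                  (I.card : ℝ) * errTerm S ρ₁ ρ₂ ρ₃ ρ₄ (coefSup s D a J) b t) ≤
                ∫ z, cutoffBoltzmann (hamiltonian s D κ a J) I b z ∂gaussianFieldOfKernel K := by
  classical
  -- the contraction, fixed from the class constants
  obtain ⟨hγ0, hγ1, hsmallγ, hquarter⟩ := gamma_rows hJcγ hV0 hM0 hM₂0 hV₄0
  set γ : ℝ := min 1 ((γA - Jc) / (4 * (V * M + M₂ * V₄) + 1)) with hγdef
  have hγA0 : 0 < γA := by linarith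
  have hhalf : 1 / γA ≤ 1 / 2 := one_div_le_one_div_of_le two_pos hγA2
  -- the threshold: the packs' `b*` at this `γ`, and the far threshold of the upper centre row
  refine ⟨max (6 * 2 ^ d * ((d + 1).factorial : ℝ) * (4 / (γ ^ d) ^ 2) ^ (d + 1)
      + 10 * (d + 1) * ((⌈1 / (2 * θ) + Real.sqrt (Jc / γA) / θ⌉₊ + 1 : ℕ) : ℝ) + 2 / (γ ^ (d + 1) * Real.sqrt γA) + (γ ^ (d + 1))⁻¹ + 1)
      (16 * (M₂ * V₄) / (θ * (γA - Jc)) + 1), fun t D κ hκ => ?_⟩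
  -- the exponents at the packs' floors (the upper `ρ₄`-floor dominates the lower one)
  have hρ₄' : 8 * s1Const D D d κ * 1 ^ D * 2 ^ d + 1 ≤ 8 * s1Const D D d κ * (γ ^ (d + 1))⁻¹ ^ D * 2 ^ d + 1 := by
    have hS : 0 ≤ s1Const D D d κ := B1Eq324BenfattoSect5ErrTermLedger.s1Const_nonneg D D d hκ.le
    have h1 : (1 : ℝ) ^ D ≤ (γ ^ (d + 1))⁻¹ ^ D := by
      rw [one_pow]
      exact one_le_pow₀ (one_le_inv_iff₀.mpr ⟨pow_pos hγ0 _, pow_le_one₀ hγ0.le hγ1⟩)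
    have h2 : 0 ≤ 8 * s1Const D D d κ := by positivity
    nlinarith [mul_le_mul_of_nonneg_left h1 h2, pow_nonneg (zero_le_two (α := ℝ)) d]
  obtain ⟨S₇, δ₇, hS₇, hδ₇, hδle₇, hres₇, hall₇⟩ := lowerpack_class' hd hγA0 hJc0 hJcγ hθ hV0 hM0 hV₂0 hM₂0 hV₄0 hγ0 hγ1 t D hκ
    (ρ₁ := (D : ℝ) + 2 * d) (ρ₂ := 0) (ρ₃ := (D : ℝ) + 2 * d) le_rfl le_rfl le_rfl hρ₄' (le_max_left _ (16 * (M₂ * V₄) / (θ * (γA - Jc)) + 1))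
  obtain ⟨S₆, δ₆, hS₆, hδ₆, hδle₆, hres₆, hall₆⟩ := upperpack_class hd hγA0 hJc0 hJcγ hθ hV0 hM0 hV₂0 hM₂0 hV₄0 hγ0 hγ1 t D hκ
    (ρ₁ := (D : ℝ) + 2 * d) (ρ₂ := 0) (ρ₃ := (D : ℝ) + 2 * d) le_rfl le_rfl le_rfl le_rfl (le_max_left _ (16 * (M₂ * V₄) / (θ * (γA - Jc)) + 1))
  have hρ₄0 : (0 : ℝ) ≤ 8 * s1Const D D d κ * (γ ^ (d + 1))⁻¹ ^ D * 2 ^ d + 1 :=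
    add_nonneg (mul_nonneg (mul_nonneg (mul_nonneg (by norm_num) (B1Eq324BenfattoSect5ErrTermLedger.s1Const_nonneg D D d hκ.le))
      (pow_nonneg (inv_nonneg.mpr (pow_nonneg hγ0.le _)) _)) (pow_nonneg zero_le_two _)) zero_le_one
  refine ⟨max S₇ S₆, (D : ℝ) + 2 * d, 0, (D : ℝ) + 2 * d, 8 * s1Const D D d κ * (γ ^ (d + 1))⁻¹ ^ D * 2 ^ d + 1,
    le_max_of_le_left hS₇, by positivity, le_rfl, by positivity, hρ₄0, ?_⟩
  intro Λ A K hK hΛ hAs hγA hJc hV hM hV₂ hM₂ hV₄ s b hb I J hI hJI hpad a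
  have hbU : 16 * (M₂ * V₄) / (θ * (γA - Jc)) + 1 ≤ b := (le_max_right _ _).trans hb.le
  have hb0 : 0 ≤ b := by
    have : 0 ≤ 16 * (M₂ * V₄) / (θ * (γA - Jc)) := by
      have hg : 0 < γA - Jc := by linarith
      positivity
    linarith
  have hA0 : 0 ≤ coefSup s D a J := coefSup_nonneg s D a J
  have hI1 : (1 : ℝ) ≤ (I.card : ℝ) := by exact_mod_cast Finset.card_pos.mpr hI
  have hI0 : (0 : ℝ) ≤ (I.card : ℝ) := Nat.cast_nonneg _
  have hmono₇ := mul_le_mul_of_nonneg_left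
    (errTerm_mono (ρ₁ := (D : ℝ) + 2 * d) (ρ₂ := 0) (ρ₃ := (D : ℝ) + 2 * d)
      (ρ₄ := 8 * s1Const D D d κ * (γ ^ (d + 1))⁻¹ ^ D * 2 ^ d + 1) (t := t) (le_max_left S₇ S₆) hA0 hb0) hI0
  have hmono₆ := mul_le_mul_of_nonneg_left
    (errTerm_mono (ρ₁ := (D : ℝ) + 2 * d) (ρ₂ := 0) (ρ₃ := (D : ℝ) + 2 * d)
      (ρ₄ := 8 * s1Const D D d κ * (γ ^ (d + 1))⁻¹ ^ D * 2 ^ d + 1) (t := t) (le_max_right S₇ S₆) hA0 hb0) hI0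
  constructor
  · -- (4.6): the upper pack at `b`, its pavement, the per-member upper theorem, then `S₄₆ ≤ S`
    intro C zbar hC0 hCfar
    obtain ⟨L, w, v, hLdef, hwv, hL2, hfit, hv, hw, hb1, hsmall, hguard, hW1, hW2, hwv3, hclause⟩ := hall₆ b hb
    have hsmallU : M₂ * V₄ / (γA - Jc) * (γ + Real.exp (-(θ / 4 * b ^ 3))) ≤ 1 / 2 := by
      rw [mul_add]
      linarith [far_term_le_quarter hJcγ hθ hM₂0 hV₄0 hbU]
    have h46 := ineq46_class_of_pack hK hΛ hAs hγA0 hγA hθ hJc hJcγ hV hM hV₂ hM₂ hV₄ hJc0 hV0 hM0 hV₂0 hM₂0 hV₄0 hhalf hκ hγ0 hγ1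
      hsmallU hδ₆ hδle₆ hres₆ t hL2 hfit hv hw hb1 hsmall hguard hW1 hW2 hJI a rfl (pad_of_sq_pad hLdef hpad) hC0
      (far_of_far hLdef hCfar) zbar (fun n hn => hclause s n (I.card : ℝ) (coefSup s D a J) hn hI1 hA0)
    exact h46.trans (Real.exp_le_exp.mpr (by linarith))
  · -- (4.7): the lower pack at `b`, its pavement, the per-member lower theorem, then `S₄₇ ≤ S`
    obtain ⟨L, w, v, hLdef, hwv, hL2, hfit, hv, hw, hgb1, hsmall, hguard, hW1, hW2, hterm, hclause⟩ := hall₇ b hb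
    have h47 := ineq47_class_of_pack hK hΛ hAs hγA0 hγA hθ hJc hJcγ hV hM hV₂ hM₂ hV₄ hJc0 hV0 hM0 hV₂0 hM₂0 hV₄0 hhalf hκ hγ0 hγ1
      hsmallγ hδ₇ hδle₇ hres₇ t hL2 hfit hv hw hgb1 hsmall hguard hW1 hW2 hterm hJI hI a rfl (pad_of_sq_pad hLdef hpad)
      (fun n hn => hclause s n (I.card : ℝ) (coefSup s D a J) hn hI1 hA0)
    exact le_trans (Real.exp_le_exp.mpr (by linarith)) h47

end Knit

end Literature.MathematicalPhysics.QuantumFieldTheory.Balaban1983to89.B1Eq324BenfattoKernelSect5ClassBasicLemma
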